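import Summits.Parity.BatemanHorn.Theses.RoughParitySectors
import Summits.Parity.BatemanHorn.Theorems.RoughParitySectorsOddSectorShareLinearMixedShareStepAux
import HarnessLib

/-!
# Route `RoughParitySectors`, crux `OddSectorShareLinear` (stmt-Parity-15629), line `birth`:
# the open stub D in its one-background ("mixed share step") forms, and the crux from the steps

`--supports stmt-Parity-15629` file (line lead, cycle 2).  Notation: all-linear Bateman–Horn system
`f = (f₀,…,f_{k−1})`, depth `U`, `R = R_f(x,U)` the jointly rough set, mixed cells
`c⁽ʲ⁾ = #{n ∈ R : Ω(fᵢ(n)) = 1 (i < j), Ω(fᵢ(n)) odd (i ≥ j)}` (`c⁽⁰⁾ = c_odd`, `c⁽ᵏ⁾ = c₁`), member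
`m`'s marginal prime / odd cells `P_m, O_m`, `A₁(U) = U e^{−γ}/2`, and `T(U) = Σ_{j odd ≤ ⌊U⌋} I_j(U)`
the odd Buchstab mass of the rough integers (`I_j = roughCellDensity j`, Alladi's cell densities).

The registered open stub of the line is the background decoupling D
`|c⁽ᵐ⁺¹⁾·O_m − c⁽ᵐ⁾·P_m| ≤ η·c⁽ᵐ⁾·P_m` (`U ≥ U₀(η)`, eventually in `x`).  This file proves that,
system by system and member by member, D is EQUIVALENT (given the tree theorems S'a, S'b ∘ B, S'', Z
of the line) to each of the ONE-BACKGROUND statements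
  STEP     `|c⁽ᵐ⁺¹⁾·A₁(U) − c⁽ᵐ⁾| ≤ η·c⁽ᵐ⁾`,     ANATOMY  `|c⁽ᵐ⁺¹⁾·T(U) − c⁽ᵐ⁾| ≤ η·c⁽ᵐ⁾`
(`U ≥ U₀(η)`, eventually in `x`) — "on the background `members < m prime, members > m odd-rough`,
member `m`'s primes have, within its odd sector, the INTEGER share `1/T(U) ∼ 2e^γ/U`", verbatim the
shape Bombieri's single-ghost law delivers for `(f_m(n))_{n ∈ background}` (odd cells
`= δ_x·I_j(U)·scale`, the ghost cancelling inside the odd sector, GIVEN a floor `δ_x ≥ δ₀ > 0`) —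
and that the `k` steps compose DIRECTLY to the crux by telescoping, without passing through D.
Bookkeeping: `…MixedShareStepAux.lean`; everything used is PROVED in the tree; no definition.
-/

noncomputable section

open Filter Finset Polynomial
open scoped BigOperators Topology
open Literature.NumberTheory.Sieve

namespace Summit.Parity.BatemanHorn.Cruxes.OddSectorShareLinear.Birth

/-! ### Instantiation at the crux's inline cells

Cells are written verbatim as in the registered stubs of the line (no definition is introduced):
`R` = the jointly rough set, the mixed cells `c⁽ʲ⁾`, member `m`'s marginal cells `P_m`, `O_m`. -/

/-- **Mixed share step from D** (system `f`, member `m`): D `c⁽ᵐ⁺¹⁾·O_m ≈ c⁽ᵐ⁾·P_m` and the tree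
theorems S'a, S'b ∘ B, S'', Z of the line give `|c⁽ᵐ⁺¹⁾·A₁(U) − c⁽ᵐ⁾| ≤ η·c⁽ᵐ⁾` for `U ≥ U₀(η)`,
eventually in `x` (the tree's `ShareOfDecoupling.memberStep_ev`, instantiated). [folklore] -/
theorem mixedShareStep_of_backgroundDecoupling :
    ∀ (k : ℕ) (f : Fin k → Polynomial ℤ), Literature.NumberTheory.Sieve.IsBatemanHornSystem f → (∀
    i, (f i).natDegree ≤ 1) → ∀ m : Fin k, (∀ η : ℝ, 0 < η → ∃ U₀ : ℝ, ∀ U : ℝ, U₀ ≤ U → ∀ᶠ x : ℕ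
    in Filter.atTop, |(((((Finset.Icc 1 x).filter (fun n : ℕ => ∀ i, 0 < (f i).eval (n : ℤ) ∧ ∀ p ∈
    Finset.range ⌈(x : ℝ) ^ (((f i).natDegree : ℝ) / U)⌉₊, p.Prime → ¬ ((p : ℤ) ∣ (f i).eval (n :
    ℤ)))).filter (fun n : ℕ => ∀ i : Fin k, ((i : ℕ) < (m : ℕ) + 1 → ArithmeticFunction.cardFactors
    (((f i).eval (n : ℤ)).toNat) = 1) ∧ ((m : ℕ) + 1 ≤ (i : ℕ) → Odd
    (ArithmeticFunction.cardFactors (((f i).eval (n : ℤ)).toNat))))).card : ℕ) : ℝ) *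
    (((((Finset.Icc 1 x).filter (fun n : ℕ => ∀ i, 0 < (f i).eval (n : ℤ) ∧ ∀ p ∈ Finset.range ⌈(x
    : ℝ) ^ (((f i).natDegree : ℝ) / U)⌉₊, p.Prime → ¬ ((p : ℤ) ∣ (f i).eval (n : ℤ)))).filter (fun
    n : ℕ => Odd (ArithmeticFunction.cardFactors (((f m).eval (n : ℤ)).toNat)))).card : ℕ) : ℝ) -
    (((((Finset.Icc 1 x).filter (fun n : ℕ => ∀ i, 0 < (f i).eval (n : ℤ) ∧ ∀ p ∈ Finset.range ⌈(x
    : ℝ) ^ (((f i).natDegree : ℝ) / U)⌉₊, p.Prime → ¬ ((p : ℤ) ∣ (f i).eval (n : ℤ)))).filter (fun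
    n : ℕ => ∀ i : Fin k, ((i : ℕ) < (m : ℕ) → ArithmeticFunction.cardFactors (((f i).eval (n :
    ℤ)).toNat) = 1) ∧ ((m : ℕ) ≤ (i : ℕ) → Odd (ArithmeticFunction.cardFactors (((f i).eval (n :
    ℤ)).toNat))))).card : ℕ) : ℝ) * (((((Finset.Icc 1 x).filter (fun n : ℕ => ∀ i, 0 < (f i).eval
    (n : ℤ) ∧ ∀ p ∈ Finset.range ⌈(x : ℝ) ^ (((f i).natDegree : ℝ) / U)⌉₊, p.Prime → ¬ ((p : ℤ) ∣
    (f i).eval (n : ℤ)))).filter (fun n : ℕ => ArithmeticFunction.cardFactors (((f m).eval (n :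
    ℤ)).toNat) = 1)).card : ℕ) : ℝ)| ≤ η * ((((((Finset.Icc 1 x).filter (fun n : ℕ => ∀ i, 0 < (f
    i).eval (n : ℤ) ∧ ∀ p ∈ Finset.range ⌈(x : ℝ) ^ (((f i).natDegree : ℝ) / U)⌉₊, p.Prime → ¬ ((p
    : ℤ) ∣ (f i).eval (n : ℤ)))).filter (fun n : ℕ => ∀ i : Fin k, ((i : ℕ) < (m : ℕ) →
    ArithmeticFunction.cardFactors (((f i).eval (n : ℤ)).toNat) = 1) ∧ ((m : ℕ) ≤ (i : ℕ) → Odd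
    (ArithmeticFunction.cardFactors (((f i).eval (n : ℤ)).toNat))))).card : ℕ) : ℝ) *
    (((((Finset.Icc 1 x).filter (fun n : ℕ => ∀ i, 0 < (f i).eval (n : ℤ) ∧ ∀ p ∈ Finset.range ⌈(x
    : ℝ) ^ (((f i).natDegree : ℝ) / U)⌉₊, p.Prime → ¬ ((p : ℤ) ∣ (f i).eval (n : ℤ)))).filter (fun
    n : ℕ => ArithmeticFunction.cardFactors (((f m).eval (n : ℤ)).toNat) = 1)).card : ℕ) : ℝ))) →
    (∀ η : ℝ, 0 < η → ∃ U₀ : ℝ, ∀ U : ℝ, U₀ ≤ U → ∀ᶠ x : ℕ in Filter.atTop, |(((((Finset.Icc 1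
    x).filter (fun n : ℕ => ∀ i, 0 < (f i).eval (n : ℤ) ∧ ∀ p ∈ Finset.range ⌈(x : ℝ) ^ (((f
    i).natDegree : ℝ) / U)⌉₊, p.Prime → ¬ ((p : ℤ) ∣ (f i).eval (n : ℤ)))).filter (fun n : ℕ => ∀ i
    : Fin k, ((i : ℕ) < (m : ℕ) + 1 → ArithmeticFunction.cardFactors (((f i).eval (n : ℤ)).toNat) =
    1) ∧ ((m : ℕ) + 1 ≤ (i : ℕ) → Odd (ArithmeticFunction.cardFactors (((f i).eval (n :
    ℤ)).toNat))))).card : ℕ) : ℝ) * (U * Real.exp (-Real.eulerMascheroniConstant) / 2) -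
    (((((Finset.Icc 1 x).filter (fun n : ℕ => ∀ i, 0 < (f i).eval (n : ℤ) ∧ ∀ p ∈ Finset.range ⌈(x
    : ℝ) ^ (((f i).natDegree : ℝ) / U)⌉₊, p.Prime → ¬ ((p : ℤ) ∣ (f i).eval (n : ℤ)))).filter (fun
    n : ℕ => ∀ i : Fin k, ((i : ℕ) < (m : ℕ) → ArithmeticFunction.cardFactors (((f i).eval (n :
    ℤ)).toNat) = 1) ∧ ((m : ℕ) ≤ (i : ℕ) → Odd (ArithmeticFunction.cardFactors (((f i).eval (n :
    ℤ)).toNat))))).card : ℕ) : ℝ)| ≤ η * (((((Finset.Icc 1 x).filter (fun n : ℕ => ∀ i, 0 < (f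
    i).eval (n : ℤ) ∧ ∀ p ∈ Finset.range ⌈(x : ℝ) ^ (((f i).natDegree : ℝ) / U)⌉₊, p.Prime → ¬ ((p
    : ℤ) ∣ (f i).eval (n : ℤ)))).filter (fun n : ℕ => ∀ i : Fin k, ((i : ℕ) < (m : ℕ) →
    ArithmeticFunction.cardFactors (((f i).eval (n : ℤ)).toNat) = 1) ∧ ((m : ℕ) ≤ (i : ℕ) → Odd
    (ArithmeticFunction.cardFactors (((f i).eval (n : ℤ)).toNat))))).card : ℕ) : ℝ)) := by
  intro k f hf hdeg m hD
  refine ShareOfDecoupling.memberStep_ev (fun U x => ?_) (fun U x => ?_)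
    ShareOfDecoupling.intPrimeCell_pos (fun U hU => by positivity) hD
    (ShareOfDecoupling.sifted_ev (fun U x => ?_) (fun U x => ?_) (fun U x => ?_)
      (ShareOfDecoupling.ratio_ev (fun U x => ?_) (stub_sieveDecouplingPrime k f hf hdeg m)
        (stub_sieveDecouplingOdd_of_roughCellsBV stub_roughCellsBV k f hf hdeg m))
      (stub_oneFormShare k f hf hdeg m))
    stub_integerShare
  -- `c⁽ᵐ⁺¹⁾ ≤ c⁽ᵐ⁾` (a prime value has odd `Ω`)
  · refine Finset.card_le_card fun n hn => ?_
    rw [Finset.mem_filter] at hn ⊢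
    refine ⟨hn.1, fun i => ⟨fun hi => (hn.2 i).1 (by omega), fun hi => ?_⟩⟩
    rcases Nat.eq_or_lt_of_le hi with h | h
    · rw [(hn.2 i).1 (by omega)]
      exact odd_one
    · exact (hn.2 i).2 (by omega)
  · refine Finset.card_le_card fun n hn => ?_
    rw [Finset.mem_filter] at hn ⊢
    exact ⟨hn.1, (hn.2 m).2 le_rfl⟩
  · refine Finset.card_le_card fun n hn => ?_
    simp only [Finset.mem_filter] at hn ⊢
    exact ⟨hn.1.1, hn.1.2 m, hn.2⟩
  · refine Finset.card_le_card fun n hn => ?_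
    simp only [Finset.mem_filter] at hn ⊢
    exact ⟨hn.1.1, hn.1.2 m, hn.2⟩
  · refine Finset.card_le_card fun n hn => ?_
    simp only [Finset.mem_filter] at hn ⊢
    refine ⟨hn.1, hn.2.1, ?_⟩
    rw [hn.2.2]
    exact odd_one
  · exact Finset.prod_nonneg fun p _ => ShareOfDecoupling.one_sub_div_card_nonneg fun c hc =>
      Finset.mem_filter.2 ⟨(Finset.mem_filter.1 hc).1, (Finset.mem_filter.1 hc).2.1⟩

/-- **D from the mixed share step** (system `f`, member `m`): conversely, `|c⁽ᵐ⁺¹⁾·A₁(U) − c⁽ᵐ⁾| ≤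
η·c⁽ᵐ⁾` and the same tree theorems S'a, S'b ∘ B, S'', Z give back the registered stub's statement D
`|c⁽ᵐ⁺¹⁾·O_m − c⁽ᵐ⁾·P_m| ≤ η·c⁽ᵐ⁾·P_m` for `U ≥ U₀(η)`, eventually in `x`.  So, system by system and
member by member, D is EQUIVALENT to the one-background share statement. [folklore] -/
theorem backgroundDecoupling_of_mixedShareStep :
    ∀ (k : ℕ) (f : Fin k → Polynomial ℤ), Literature.NumberTheory.Sieve.IsBatemanHornSystem f → (∀
    i, (f i).natDegree ≤ 1) → ∀ m : Fin k, (∀ η : ℝ, 0 < η → ∃ U₀ : ℝ, ∀ U : ℝ, U₀ ≤ U → ∀ᶠ x : ℕ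
    in Filter.atTop, |(((((Finset.Icc 1 x).filter (fun n : ℕ => ∀ i, 0 < (f i).eval (n : ℤ) ∧ ∀ p ∈
    Finset.range ⌈(x : ℝ) ^ (((f i).natDegree : ℝ) / U)⌉₊, p.Prime → ¬ ((p : ℤ) ∣ (f i).eval (n :
    ℤ)))).filter (fun n : ℕ => ∀ i : Fin k, ((i : ℕ) < (m : ℕ) + 1 → ArithmeticFunction.cardFactors
    (((f i).eval (n : ℤ)).toNat) = 1) ∧ ((m : ℕ) + 1 ≤ (i : ℕ) → Odd
    (ArithmeticFunction.cardFactors (((f i).eval (n : ℤ)).toNat))))).card : ℕ) : ℝ) * (U * Real.exp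
    (-Real.eulerMascheroniConstant) / 2) - (((((Finset.Icc 1 x).filter (fun n : ℕ => ∀ i, 0 < (f
    i).eval (n : ℤ) ∧ ∀ p ∈ Finset.range ⌈(x : ℝ) ^ (((f i).natDegree : ℝ) / U)⌉₊, p.Prime → ¬ ((p
    : ℤ) ∣ (f i).eval (n : ℤ)))).filter (fun n : ℕ => ∀ i : Fin k, ((i : ℕ) < (m : ℕ) →
    ArithmeticFunction.cardFactors (((f i).eval (n : ℤ)).toNat) = 1) ∧ ((m : ℕ) ≤ (i : ℕ) → Odd
    (ArithmeticFunction.cardFactors (((f i).eval (n : ℤ)).toNat))))).card : ℕ) : ℝ)| ≤ η *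
    (((((Finset.Icc 1 x).filter (fun n : ℕ => ∀ i, 0 < (f i).eval (n : ℤ) ∧ ∀ p ∈ Finset.range ⌈(x
    : ℝ) ^ (((f i).natDegree : ℝ) / U)⌉₊, p.Prime → ¬ ((p : ℤ) ∣ (f i).eval (n : ℤ)))).filter (fun
    n : ℕ => ∀ i : Fin k, ((i : ℕ) < (m : ℕ) → ArithmeticFunction.cardFactors (((f i).eval (n :
    ℤ)).toNat) = 1) ∧ ((m : ℕ) ≤ (i : ℕ) → Odd (ArithmeticFunction.cardFactors (((f i).eval (n :
    ℤ)).toNat))))).card : ℕ) : ℝ)) → (∀ η : ℝ, 0 < η → ∃ U₀ : ℝ, ∀ U : ℝ, U₀ ≤ U → ∀ᶠ x : ℕ in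
    Filter.atTop, |(((((Finset.Icc 1 x).filter (fun n : ℕ => ∀ i, 0 < (f i).eval (n : ℤ) ∧ ∀ p ∈
    Finset.range ⌈(x : ℝ) ^ (((f i).natDegree : ℝ) / U)⌉₊, p.Prime → ¬ ((p : ℤ) ∣ (f i).eval (n :
    ℤ)))).filter (fun n : ℕ => ∀ i : Fin k, ((i : ℕ) < (m : ℕ) + 1 → ArithmeticFunction.cardFactors
    (((f i).eval (n : ℤ)).toNat) = 1) ∧ ((m : ℕ) + 1 ≤ (i : ℕ) → Odd
    (ArithmeticFunction.cardFactors (((f i).eval (n : ℤ)).toNat))))).card : ℕ) : ℝ) *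
    (((((Finset.Icc 1 x).filter (fun n : ℕ => ∀ i, 0 < (f i).eval (n : ℤ) ∧ ∀ p ∈ Finset.range ⌈(x
    : ℝ) ^ (((f i).natDegree : ℝ) / U)⌉₊, p.Prime → ¬ ((p : ℤ) ∣ (f i).eval (n : ℤ)))).filter (fun
    n : ℕ => Odd (ArithmeticFunction.cardFactors (((f m).eval (n : ℤ)).toNat)))).card : ℕ) : ℝ) -
    (((((Finset.Icc 1 x).filter (fun n : ℕ => ∀ i, 0 < (f i).eval (n : ℤ) ∧ ∀ p ∈ Finset.range ⌈(x
    : ℝ) ^ (((f i).natDegree : ℝ) / U)⌉₊, p.Prime → ¬ ((p : ℤ) ∣ (f i).eval (n : ℤ)))).filter (fun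
    n : ℕ => ∀ i : Fin k, ((i : ℕ) < (m : ℕ) → ArithmeticFunction.cardFactors (((f i).eval (n :
    ℤ)).toNat) = 1) ∧ ((m : ℕ) ≤ (i : ℕ) → Odd (ArithmeticFunction.cardFactors (((f i).eval (n :
    ℤ)).toNat))))).card : ℕ) : ℝ) * (((((Finset.Icc 1 x).filter (fun n : ℕ => ∀ i, 0 < (f i).eval
    (n : ℤ) ∧ ∀ p ∈ Finset.range ⌈(x : ℝ) ^ (((f i).natDegree : ℝ) / U)⌉₊, p.Prime → ¬ ((p : ℤ) ∣
    (f i).eval (n : ℤ)))).filter (fun n : ℕ => ArithmeticFunction.cardFactors (((f m).eval (n :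
    ℤ)).toNat) = 1)).card : ℕ) : ℝ)| ≤ η * ((((((Finset.Icc 1 x).filter (fun n : ℕ => ∀ i, 0 < (f
    i).eval (n : ℤ) ∧ ∀ p ∈ Finset.range ⌈(x : ℝ) ^ (((f i).natDegree : ℝ) / U)⌉₊, p.Prime → ¬ ((p
    : ℤ) ∣ (f i).eval (n : ℤ)))).filter (fun n : ℕ => ∀ i : Fin k, ((i : ℕ) < (m : ℕ) →
    ArithmeticFunction.cardFactors (((f i).eval (n : ℤ)).toNat) = 1) ∧ ((m : ℕ) ≤ (i : ℕ) → Odd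
    (ArithmeticFunction.cardFactors (((f i).eval (n : ℤ)).toNat))))).card : ℕ) : ℝ) *
    (((((Finset.Icc 1 x).filter (fun n : ℕ => ∀ i, 0 < (f i).eval (n : ℤ) ∧ ∀ p ∈ Finset.range ⌈(x
    : ℝ) ^ (((f i).natDegree : ℝ) / U)⌉₊, p.Prime → ¬ ((p : ℤ) ∣ (f i).eval (n : ℤ)))).filter (fun
    n : ℕ => ArithmeticFunction.cardFactors (((f m).eval (n : ℤ)).toNat) = 1)).card : ℕ) : ℝ))) := by
  intro k f hf hdeg m hStep
  refine MixedShareStep.decoupling_ev (fun U x => ?_) (fun U x => ?_)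
    ShareOfDecoupling.intPrimeCell_pos (fun U hU => by positivity) hStep
    (ShareOfDecoupling.sifted_ev (fun U x => ?_) (fun U x => ?_) (fun U x => ?_)
      (ShareOfDecoupling.ratio_ev (fun U x => ?_) (stub_sieveDecouplingPrime k f hf hdeg m)
        (stub_sieveDecouplingOdd_of_roughCellsBV stub_roughCellsBV k f hf hdeg m))
      (stub_oneFormShare k f hf hdeg m))
    stub_integerShare
  -- `c⁽ᵐ⁺¹⁾ ≤ c⁽ᵐ⁾` (a prime value has odd `Ω`)
  · refine Finset.card_le_card fun n hn => ?_
    rw [Finset.mem_filter] at hn ⊢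
    refine ⟨hn.1, fun i => ⟨fun hi => (hn.2 i).1 (by omega), fun hi => ?_⟩⟩
    rcases Nat.eq_or_lt_of_le hi with h | h
    · rw [(hn.2 i).1 (by omega)]
      exact odd_one
    · exact (hn.2 i).2 (by omega)
  · refine Finset.card_le_card fun n hn => ?_
    rw [Finset.mem_filter] at hn ⊢
    exact ⟨hn.1, (hn.2 m).2 le_rfl⟩
  · refine Finset.card_le_card fun n hn => ?_
    simp only [Finset.mem_filter] at hn ⊢
    exact ⟨hn.1.1, hn.1.2 m, hn.2⟩
  · refine Finset.card_le_card fun n hn => ?_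
    simp only [Finset.mem_filter] at hn ⊢
    exact ⟨hn.1.1, hn.1.2 m, hn.2⟩
  · refine Finset.card_le_card fun n hn => ?_
    simp only [Finset.mem_filter] at hn ⊢
    refine ⟨hn.1, hn.2.1, ?_⟩
    rw [hn.2.2]
    exact odd_one
  · exact Finset.prod_nonneg fun p _ => ShareOfDecoupling.one_sub_div_card_nonneg fun c hc =>
      Finset.mem_filter.2 ⟨(Finset.mem_filter.1 hc).1, (Finset.mem_filter.1 hc).2.1⟩

/-- **Sub-goal**, registered on crux stmt-Parity-15629 as `stub_backgroundDecouplingOfMixedShareStep`,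
verbatim: D at `(f, m)` from the mixed share step at `(f, m)` (`backgroundDecoupling_of_mixedShareStep`).
[folklore] -/
theorem stub_backgroundDecouplingOfMixedShareStep :
    ∀ (k : ℕ) (f : Fin k → Polynomial ℤ), Literature.NumberTheory.Sieve.IsBatemanHornSystem f → (∀
    i, (f i).natDegree ≤ 1) → ∀ m : Fin k, (∀ η : ℝ, 0 < η → ∃ U₀ : ℝ, ∀ U : ℝ, U₀ ≤ U → ∀ᶠ x : ℕ
    in Filter.atTop, |(((((Finset.Icc 1 x).filter (fun n : ℕ => ∀ i, 0 < (f i).eval (n : ℤ) ∧ ∀ p ∈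
    Finset.range ⌈(x : ℝ) ^ (((f i).natDegree : ℝ) / U)⌉₊, p.Prime → ¬ ((p : ℤ) ∣ (f i).eval (n :
    ℤ)))).filter (fun n : ℕ => ∀ i : Fin k, ((i : ℕ) < (m : ℕ) + 1 → ArithmeticFunction.cardFactors
    (((f i).eval (n : ℤ)).toNat) = 1) ∧ ((m : ℕ) + 1 ≤ (i : ℕ) → Odd
    (ArithmeticFunction.cardFactors (((f i).eval (n : ℤ)).toNat))))).card : ℕ) : ℝ) * (U * Real.exp
    (-Real.eulerMascheroniConstant) / 2) - (((((Finset.Icc 1 x).filter (fun n : ℕ => ∀ i, 0 < (f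
    i).eval (n : ℤ) ∧ ∀ p ∈ Finset.range ⌈(x : ℝ) ^ (((f i).natDegree : ℝ) / U)⌉₊, p.Prime → ¬ ((p
    : ℤ) ∣ (f i).eval (n : ℤ)))).filter (fun n : ℕ => ∀ i : Fin k, ((i : ℕ) < (m : ℕ) →
    ArithmeticFunction.cardFactors (((f i).eval (n : ℤ)).toNat) = 1) ∧ ((m : ℕ) ≤ (i : ℕ) → Odd
    (ArithmeticFunction.cardFactors (((f i).eval (n : ℤ)).toNat))))).card : ℕ) : ℝ)| ≤ η *
    (((((Finset.Icc 1 x).filter (fun n : ℕ => ∀ i, 0 < (f i).eval (n : ℤ) ∧ ∀ p ∈ Finset.range ⌈(x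
    : ℝ) ^ (((f i).natDegree : ℝ) / U)⌉₊, p.Prime → ¬ ((p : ℤ) ∣ (f i).eval (n : ℤ)))).filter (fun
    n : ℕ => ∀ i : Fin k, ((i : ℕ) < (m : ℕ) → ArithmeticFunction.cardFactors (((f i).eval (n :
    ℤ)).toNat) = 1) ∧ ((m : ℕ) ≤ (i : ℕ) → Odd (ArithmeticFunction.cardFactors (((f i).eval (n :
    ℤ)).toNat))))).card : ℕ) : ℝ)) → (∀ η : ℝ, 0 < η → ∃ U₀ : ℝ, ∀ U : ℝ, U₀ ≤ U → ∀ᶠ x : ℕ in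
    Filter.atTop, |(((((Finset.Icc 1 x).filter (fun n : ℕ => ∀ i, 0 < (f i).eval (n : ℤ) ∧ ∀ p ∈
    Finset.range ⌈(x : ℝ) ^ (((f i).natDegree : ℝ) / U)⌉₊, p.Prime → ¬ ((p : ℤ) ∣ (f i).eval (n :
    ℤ)))).filter (fun n : ℕ => ∀ i : Fin k, ((i : ℕ) < (m : ℕ) + 1 → ArithmeticFunction.cardFactors
    (((f i).eval (n : ℤ)).toNat) = 1) ∧ ((m : ℕ) + 1 ≤ (i : ℕ) → Odd
    (ArithmeticFunction.cardFactors (((f i).eval (n : ℤ)).toNat))))).card : ℕ) : ℝ) *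
    (((((Finset.Icc 1 x).filter (fun n : ℕ => ∀ i, 0 < (f i).eval (n : ℤ) ∧ ∀ p ∈ Finset.range ⌈(x
    : ℝ) ^ (((f i).natDegree : ℝ) / U)⌉₊, p.Prime → ¬ ((p : ℤ) ∣ (f i).eval (n : ℤ)))).filter (fun
    n : ℕ => Odd (ArithmeticFunction.cardFactors (((f m).eval (n : ℤ)).toNat)))).card : ℕ) : ℝ) -
    (((((Finset.Icc 1 x).filter (fun n : ℕ => ∀ i, 0 < (f i).eval (n : ℤ) ∧ ∀ p ∈ Finset.range ⌈(x
    : ℝ) ^ (((f i).natDegree : ℝ) / U)⌉₊, p.Prime → ¬ ((p : ℤ) ∣ (f i).eval (n : ℤ)))).filter (fun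
    n : ℕ => ∀ i : Fin k, ((i : ℕ) < (m : ℕ) → ArithmeticFunction.cardFactors (((f i).eval (n :
    ℤ)).toNat) = 1) ∧ ((m : ℕ) ≤ (i : ℕ) → Odd (ArithmeticFunction.cardFactors (((f i).eval (n :
    ℤ)).toNat))))).card : ℕ) : ℝ) * (((((Finset.Icc 1 x).filter (fun n : ℕ => ∀ i, 0 < (f i).eval
    (n : ℤ) ∧ ∀ p ∈ Finset.range ⌈(x : ℝ) ^ (((f i).natDegree : ℝ) / U)⌉₊, p.Prime → ¬ ((p : ℤ) ∣
    (f i).eval (n : ℤ)))).filter (fun n : ℕ => ArithmeticFunction.cardFactors (((f m).eval (n :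
    ℤ)).toNat) = 1)).card : ℕ) : ℝ)| ≤ η * ((((((Finset.Icc 1 x).filter (fun n : ℕ => ∀ i, 0 < (f
    i).eval (n : ℤ) ∧ ∀ p ∈ Finset.range ⌈(x : ℝ) ^ (((f i).natDegree : ℝ) / U)⌉₊, p.Prime → ¬ ((p
    : ℤ) ∣ (f i).eval (n : ℤ)))).filter (fun n : ℕ => ∀ i : Fin k, ((i : ℕ) < (m : ℕ) →
    ArithmeticFunction.cardFactors (((f i).eval (n : ℤ)).toNat) = 1) ∧ ((m : ℕ) ≤ (i : ℕ) → Odd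
    (ArithmeticFunction.cardFactors (((f i).eval (n : ℤ)).toNat))))).card : ℕ) : ℝ) *
    (((((Finset.Icc 1 x).filter (fun n : ℕ => ∀ i, 0 < (f i).eval (n : ℤ) ∧ ∀ p ∈ Finset.range ⌈(x
    : ℝ) ^ (((f i).natDegree : ℝ) / U)⌉₊, p.Prime → ¬ ((p : ℤ) ∣ (f i).eval (n : ℤ)))).filter (fun
    n : ℕ => ArithmeticFunction.cardFactors (((f m).eval (n : ℤ)).toNat) = 1)).card : ℕ) : ℝ))) :=
  backgroundDecoupling_of_mixedShareStep

/-- **Mixed share ANATOMY from the mixed share step**: the share factor `A₁(U) = U e^{−γ}/2` may be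
replaced by the odd Buchstab mass `T(U) = Σ_{j odd ≤ ⌊U⌋} I_j(U)` of the rough integers
(`T(U)/A₁(U) → 1`, the tree's `stub_oddBuchstabMass`): `|c⁽ᵐ⁺¹⁾·T(U) − c⁽ᵐ⁾| ≤ η·c⁽ᵐ⁾` for
`U ≥ U₀(η)`, eventually in `x` — "within member `m`'s odd sector on the background, the primes have
the integers' share `I_1(U)/Σ_{j odd} I_j(U)`", the shape of statement Bombieri's single-ghost law
produces. [folklore] -/
theorem mixedShareAnatomy_of_mixedShareStep :
    ∀ (k : ℕ) (f : Fin k → Polynomial ℤ) (m : Fin k), (∀ η : ℝ, 0 < η → ∃ U₀ : ℝ, ∀ U : ℝ, U₀ ≤ U →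
    ∀ᶠ x : ℕ in Filter.atTop, |(((((Finset.Icc 1 x).filter (fun n : ℕ => ∀ i, 0 < (f i).eval (n :
    ℤ) ∧ ∀ p ∈ Finset.range ⌈(x : ℝ) ^ (((f i).natDegree : ℝ) / U)⌉₊, p.Prime → ¬ ((p : ℤ) ∣ (f
    i).eval (n : ℤ)))).filter (fun n : ℕ => ∀ i : Fin k, ((i : ℕ) < (m : ℕ) + 1 →
    ArithmeticFunction.cardFactors (((f i).eval (n : ℤ)).toNat) = 1) ∧ ((m : ℕ) + 1 ≤ (i : ℕ) → Odd
    (ArithmeticFunction.cardFactors (((f i).eval (n : ℤ)).toNat))))).card : ℕ) : ℝ) * (U * Real.exp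
    (-Real.eulerMascheroniConstant) / 2) - (((((Finset.Icc 1 x).filter (fun n : ℕ => ∀ i, 0 < (f
    i).eval (n : ℤ) ∧ ∀ p ∈ Finset.range ⌈(x : ℝ) ^ (((f i).natDegree : ℝ) / U)⌉₊, p.Prime → ¬ ((p
    : ℤ) ∣ (f i).eval (n : ℤ)))).filter (fun n : ℕ => ∀ i : Fin k, ((i : ℕ) < (m : ℕ) →
    ArithmeticFunction.cardFactors (((f i).eval (n : ℤ)).toNat) = 1) ∧ ((m : ℕ) ≤ (i : ℕ) → Odd
    (ArithmeticFunction.cardFactors (((f i).eval (n : ℤ)).toNat))))).card : ℕ) : ℝ)| ≤ η *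
    (((((Finset.Icc 1 x).filter (fun n : ℕ => ∀ i, 0 < (f i).eval (n : ℤ) ∧ ∀ p ∈ Finset.range ⌈(x
    : ℝ) ^ (((f i).natDegree : ℝ) / U)⌉₊, p.Prime → ¬ ((p : ℤ) ∣ (f i).eval (n : ℤ)))).filter (fun
    n : ℕ => ∀ i : Fin k, ((i : ℕ) < (m : ℕ) → ArithmeticFunction.cardFactors (((f i).eval (n :
    ℤ)).toNat) = 1) ∧ ((m : ℕ) ≤ (i : ℕ) → Odd (ArithmeticFunction.cardFactors (((f i).eval (n :
    ℤ)).toNat))))).card : ℕ) : ℝ)) → (∀ η : ℝ, 0 < η → ∃ U₀ : ℝ, ∀ U : ℝ, U₀ ≤ U → ∀ᶠ x : ℕ in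
    Filter.atTop, |(((((Finset.Icc 1 x).filter (fun n : ℕ => ∀ i, 0 < (f i).eval (n : ℤ) ∧ ∀ p ∈
    Finset.range ⌈(x : ℝ) ^ (((f i).natDegree : ℝ) / U)⌉₊, p.Prime → ¬ ((p : ℤ) ∣ (f i).eval (n :
    ℤ)))).filter (fun n : ℕ => ∀ i : Fin k, ((i : ℕ) < (m : ℕ) + 1 → ArithmeticFunction.cardFactors
    (((f i).eval (n : ℤ)).toNat) = 1) ∧ ((m : ℕ) + 1 ≤ (i : ℕ) → Odd
    (ArithmeticFunction.cardFactors (((f i).eval (n : ℤ)).toNat))))).card : ℕ) : ℝ) * (∑ j ∈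
    (Finset.range (⌊U⌋₊ + 1)).filter Odd, Literature.NumberTheory.Sieve.roughCellDensity j U) -
    (((((Finset.Icc 1 x).filter (fun n : ℕ => ∀ i, 0 < (f i).eval (n : ℤ) ∧ ∀ p ∈ Finset.range ⌈(x
    : ℝ) ^ (((f i).natDegree : ℝ) / U)⌉₊, p.Prime → ¬ ((p : ℤ) ∣ (f i).eval (n : ℤ)))).filter (fun
    n : ℕ => ∀ i : Fin k, ((i : ℕ) < (m : ℕ) → ArithmeticFunction.cardFactors (((f i).eval (n :
    ℤ)).toNat) = 1) ∧ ((m : ℕ) ≤ (i : ℕ) → Odd (ArithmeticFunction.cardFactors (((f i).eval (n :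
    ℤ)).toNat))))).card : ℕ) : ℝ)| ≤ η * (((((Finset.Icc 1 x).filter (fun n : ℕ => ∀ i, 0 < (f
    i).eval (n : ℤ) ∧ ∀ p ∈ Finset.range ⌈(x : ℝ) ^ (((f i).natDegree : ℝ) / U)⌉₊, p.Prime → ¬ ((p
    : ℤ) ∣ (f i).eval (n : ℤ)))).filter (fun n : ℕ => ∀ i : Fin k, ((i : ℕ) < (m : ℕ) →
    ArithmeticFunction.cardFactors (((f i).eval (n : ℤ)).toNat) = 1) ∧ ((m : ℕ) ≤ (i : ℕ) → Odd
    (ArithmeticFunction.cardFactors (((f i).eval (n : ℤ)).toNat))))).card : ℕ) : ℝ)) := by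
  intro k f m hStep
  exact MixedShareStep.step_congr (U₁ := 1) (fun U hU => MixedShareStep.shareA_pos U (by linarith))
    MixedShareStep.tendsto_oddMass_div_shareA hStep

/-- **Mixed share step from the mixed share anatomy** (converse exchange of the share factor,
`A₁(U)/T(U) → 1`). [folklore] -/
theorem mixedShareStep_of_mixedShareAnatomy :
    ∀ (k : ℕ) (f : Fin k → Polynomial ℤ) (m : Fin k), (∀ η : ℝ, 0 < η → ∃ U₀ : ℝ, ∀ U : ℝ, U₀ ≤ U →
    ∀ᶠ x : ℕ in Filter.atTop, |(((((Finset.Icc 1 x).filter (fun n : ℕ => ∀ i, 0 < (f i).eval (n :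
    ℤ) ∧ ∀ p ∈ Finset.range ⌈(x : ℝ) ^ (((f i).natDegree : ℝ) / U)⌉₊, p.Prime → ¬ ((p : ℤ) ∣ (f
    i).eval (n : ℤ)))).filter (fun n : ℕ => ∀ i : Fin k, ((i : ℕ) < (m : ℕ) + 1 →
    ArithmeticFunction.cardFactors (((f i).eval (n : ℤ)).toNat) = 1) ∧ ((m : ℕ) + 1 ≤ (i : ℕ) → Odd
    (ArithmeticFunction.cardFactors (((f i).eval (n : ℤ)).toNat))))).card : ℕ) : ℝ) * (∑ j ∈
    (Finset.range (⌊U⌋₊ + 1)).filter Odd, Literature.NumberTheory.Sieve.roughCellDensity j U) -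
    (((((Finset.Icc 1 x).filter (fun n : ℕ => ∀ i, 0 < (f i).eval (n : ℤ) ∧ ∀ p ∈ Finset.range ⌈(x
    : ℝ) ^ (((f i).natDegree : ℝ) / U)⌉₊, p.Prime → ¬ ((p : ℤ) ∣ (f i).eval (n : ℤ)))).filter (fun
    n : ℕ => ∀ i : Fin k, ((i : ℕ) < (m : ℕ) → ArithmeticFunction.cardFactors (((f i).eval (n :
    ℤ)).toNat) = 1) ∧ ((m : ℕ) ≤ (i : ℕ) → Odd (ArithmeticFunction.cardFactors (((f i).eval (n :
    ℤ)).toNat))))).card : ℕ) : ℝ)| ≤ η * (((((Finset.Icc 1 x).filter (fun n : ℕ => ∀ i, 0 < (f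
    i).eval (n : ℤ) ∧ ∀ p ∈ Finset.range ⌈(x : ℝ) ^ (((f i).natDegree : ℝ) / U)⌉₊, p.Prime → ¬ ((p
    : ℤ) ∣ (f i).eval (n : ℤ)))).filter (fun n : ℕ => ∀ i : Fin k, ((i : ℕ) < (m : ℕ) →
    ArithmeticFunction.cardFactors (((f i).eval (n : ℤ)).toNat) = 1) ∧ ((m : ℕ) ≤ (i : ℕ) → Odd
    (ArithmeticFunction.cardFactors (((f i).eval (n : ℤ)).toNat))))).card : ℕ) : ℝ)) → (∀ η : ℝ, 0
    < η → ∃ U₀ : ℝ, ∀ U : ℝ, U₀ ≤ U → ∀ᶠ x : ℕ in Filter.atTop, |(((((Finset.Icc 1 x).filter (fun n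
    : ℕ => ∀ i, 0 < (f i).eval (n : ℤ) ∧ ∀ p ∈ Finset.range ⌈(x : ℝ) ^ (((f i).natDegree : ℝ) /
    U)⌉₊, p.Prime → ¬ ((p : ℤ) ∣ (f i).eval (n : ℤ)))).filter (fun n : ℕ => ∀ i : Fin k, ((i : ℕ) <
    (m : ℕ) + 1 → ArithmeticFunction.cardFactors (((f i).eval (n : ℤ)).toNat) = 1) ∧ ((m : ℕ) + 1 ≤
    (i : ℕ) → Odd (ArithmeticFunction.cardFactors (((f i).eval (n : ℤ)).toNat))))).card : ℕ) : ℝ) *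
    (U * Real.exp (-Real.eulerMascheroniConstant) / 2) - (((((Finset.Icc 1 x).filter (fun n : ℕ =>
    ∀ i, 0 < (f i).eval (n : ℤ) ∧ ∀ p ∈ Finset.range ⌈(x : ℝ) ^ (((f i).natDegree : ℝ) / U)⌉₊,
    p.Prime → ¬ ((p : ℤ) ∣ (f i).eval (n : ℤ)))).filter (fun n : ℕ => ∀ i : Fin k, ((i : ℕ) < (m :
    ℕ) → ArithmeticFunction.cardFactors (((f i).eval (n : ℤ)).toNat) = 1) ∧ ((m : ℕ) ≤ (i : ℕ) →
    Odd (ArithmeticFunction.cardFactors (((f i).eval (n : ℤ)).toNat))))).card : ℕ) : ℝ)| ≤ η *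
    (((((Finset.Icc 1 x).filter (fun n : ℕ => ∀ i, 0 < (f i).eval (n : ℤ) ∧ ∀ p ∈ Finset.range ⌈(x
    : ℝ) ^ (((f i).natDegree : ℝ) / U)⌉₊, p.Prime → ¬ ((p : ℤ) ∣ (f i).eval (n : ℤ)))).filter (fun
    n : ℕ => ∀ i : Fin k, ((i : ℕ) < (m : ℕ) → ArithmeticFunction.cardFactors (((f i).eval (n :
    ℤ)).toNat) = 1) ∧ ((m : ℕ) ≤ (i : ℕ) → Odd (ArithmeticFunction.cardFactors (((f i).eval (n :
    ℤ)).toNat))))).card : ℕ) : ℝ)) := by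
  intro k f m hStep
  refine MixedShareStep.step_congr (A := fun U => (∑ j ∈ (Finset.range (⌊U⌋₊ + 1)).filter Odd, Literature.NumberTheory.Sieve.roughCellDensity j U))
    (B := fun U => (U * Real.exp (-Real.eulerMascheroniConstant) / 2)) (U₁ := 1)
    (fun U hU => MixedShareStep.oddMass_pos U hU) IntegerShare.tendsto_half_mul_div_oddMass hStep

/-- **The crux from the mixed share steps, directly**: if every all-linear Bateman–Horn system
satisfies, member by member, `|c⁽ᵐ⁺¹⁾·A₁(U) − c⁽ᵐ⁾| ≤ η·c⁽ᵐ⁾` (`U ≥ U₀(η)`, eventually in `x`),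
then `OddSectorShareLinear` holds — the `k` steps telescope (`ShareOfDecoupling.share_of_steps`,
`c⁽ᵏ⁾ = c₁`, `c⁽⁰⁾ = c_odd`); no sieve theorem is needed on this path. [folklore] -/
theorem OddSectorShareLinear_of_mixedShareSteps
    (hSteps : ∀ (k : ℕ) (f : Fin k → Polynomial ℤ), Literature.NumberTheory.Sieve.IsBatemanHornSystem f →
      (∀ i, (f i).natDegree ≤ 1) → ∀ m : Fin k, (∀ η : ℝ, 0 < η → ∃ U₀ : ℝ, ∀ U : ℝ, U₀ ≤ U → ∀ᶠ x
      : ℕ in Filter.atTop, |(((((Finset.Icc 1 x).filter (fun n : ℕ => ∀ i, 0 < (f i).eval (n : ℤ) ∧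
      ∀ p ∈ Finset.range ⌈(x : ℝ) ^ (((f i).natDegree : ℝ) / U)⌉₊, p.Prime → ¬ ((p : ℤ) ∣ (f
      i).eval (n : ℤ)))).filter (fun n : ℕ => ∀ i : Fin k, ((i : ℕ) < (m : ℕ) + 1 →
      ArithmeticFunction.cardFactors (((f i).eval (n : ℤ)).toNat) = 1) ∧ ((m : ℕ) + 1 ≤ (i : ℕ) →
      Odd (ArithmeticFunction.cardFactors (((f i).eval (n : ℤ)).toNat))))).card : ℕ) : ℝ) * (U *
      Real.exp (-Real.eulerMascheroniConstant) / 2) - (((((Finset.Icc 1 x).filter (fun n : ℕ => ∀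
      i, 0 < (f i).eval (n : ℤ) ∧ ∀ p ∈ Finset.range ⌈(x : ℝ) ^ (((f i).natDegree : ℝ) / U)⌉₊,
      p.Prime → ¬ ((p : ℤ) ∣ (f i).eval (n : ℤ)))).filter (fun n : ℕ => ∀ i : Fin k, ((i : ℕ) < (m
      : ℕ) → ArithmeticFunction.cardFactors (((f i).eval (n : ℤ)).toNat) = 1) ∧ ((m : ℕ) ≤ (i : ℕ)
      → Odd (ArithmeticFunction.cardFactors (((f i).eval (n : ℤ)).toNat))))).card : ℕ) : ℝ)| ≤ η *
      (((((Finset.Icc 1 x).filter (fun n : ℕ => ∀ i, 0 < (f i).eval (n : ℤ) ∧ ∀ p ∈ Finset.range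
      ⌈(x : ℝ) ^ (((f i).natDegree : ℝ) / U)⌉₊, p.Prime → ¬ ((p : ℤ) ∣ (f i).eval (n : ℤ)))).filter
      (fun n : ℕ => ∀ i : Fin k, ((i : ℕ) < (m : ℕ) → ArithmeticFunction.cardFactors (((f i).eval
      (n : ℤ)).toNat) = 1) ∧ ((m : ℕ) ≤ (i : ℕ) → Odd (ArithmeticFunction.cardFactors (((f i).eval
      (n : ℤ)).toNat))))).card : ℕ) : ℝ))) :
    Summit.Parity.BatemanHorn.Theses.RoughParitySectors.OddSectorShareLinear := by
  unfold Summit.Parity.BatemanHorn.Theses.RoughParitySectors.OddSectorShareLinear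
  intro k f hf hdeg
  refine ShareOfDecoupling.share_of_steps
    (fun (j : ℕ) (U : ℝ) (x : ℕ) => (((Finset.Icc 1 x).filter (fun n : ℕ => ∀ i, 0 < (f i).eval (n : ℤ) ∧ ∀ p ∈ Finset.range ⌈(x : ℝ) ^ (((f i).natDegree : ℝ) / U)⌉₊, p.Prime → ¬ ((p : ℤ) ∣ (f i).eval (n : ℤ)))).filter (fun n : ℕ => ∀ i : Fin k, ((i : ℕ) < j →
      ArithmeticFunction.cardFactors (((f i).eval (n : ℤ)).toNat) = 1) ∧ (j ≤ (i : ℕ) →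
      Odd (ArithmeticFunction.cardFactors (((f i).eval (n : ℤ)).toNat))))).card)
    (fun U hU => by positivity) (fun U x => ?_) (fun U x => ?_) (fun m => hSteps k f hf hdeg m)
  -- `c⁽ᵏ⁾ = c₁`
  · refine congrArg Finset.card (Finset.filter_congr fun n _ => ?_)
    exact ⟨fun h i => (h i).1 i.is_lt,
      fun h i => ⟨fun _ => h i, fun hk => absurd i.is_lt (not_lt.2 hk)⟩⟩
  -- `c⁽⁰⁾ = c_odd`
  · refine congrArg Finset.card (Finset.filter_congr fun n _ => ?_)
    exact ⟨fun h i => (h i).2 (Nat.zero_le _), fun h i => ⟨fun hi => absurd hi (Nat.not_lt_zero _),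
      fun _ => h i⟩⟩

/-- **The crux from the mixed share anatomy**: the same with the odd Buchstab mass `T(U)` as the
share factor — `OddSectorShareLinear` follows from "on every background `members < m prime,
members > m odd-rough`, member `m`'s primes have the integer share `1/T(U)` of its odd sector"
for all all-linear systems and all members. [folklore] -/
theorem OddSectorShareLinear_of_mixedShareAnatomy
    (hAnat : ∀ (k : ℕ) (f : Fin k → Polynomial ℤ), Literature.NumberTheory.Sieve.IsBatemanHornSystem f →
      (∀ i, (f i).natDegree ≤ 1) → ∀ m : Fin k, (∀ η : ℝ, 0 < η → ∃ U₀ : ℝ, ∀ U : ℝ, U₀ ≤ U → ∀ᶠ x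
      : ℕ in Filter.atTop, |(((((Finset.Icc 1 x).filter (fun n : ℕ => ∀ i, 0 < (f i).eval (n : ℤ) ∧
      ∀ p ∈ Finset.range ⌈(x : ℝ) ^ (((f i).natDegree : ℝ) / U)⌉₊, p.Prime → ¬ ((p : ℤ) ∣ (f
      i).eval (n : ℤ)))).filter (fun n : ℕ => ∀ i : Fin k, ((i : ℕ) < (m : ℕ) + 1 →
      ArithmeticFunction.cardFactors (((f i).eval (n : ℤ)).toNat) = 1) ∧ ((m : ℕ) + 1 ≤ (i : ℕ) →
      Odd (ArithmeticFunction.cardFactors (((f i).eval (n : ℤ)).toNat))))).card : ℕ) : ℝ) * (∑ j ∈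
      (Finset.range (⌊U⌋₊ + 1)).filter Odd, Literature.NumberTheory.Sieve.roughCellDensity j U) -
      (((((Finset.Icc 1 x).filter (fun n : ℕ => ∀ i, 0 < (f i).eval (n : ℤ) ∧ ∀ p ∈ Finset.range
      ⌈(x : ℝ) ^ (((f i).natDegree : ℝ) / U)⌉₊, p.Prime → ¬ ((p : ℤ) ∣ (f i).eval (n : ℤ)))).filter
      (fun n : ℕ => ∀ i : Fin k, ((i : ℕ) < (m : ℕ) → ArithmeticFunction.cardFactors (((f i).eval
      (n : ℤ)).toNat) = 1) ∧ ((m : ℕ) ≤ (i : ℕ) → Odd (ArithmeticFunction.cardFactors (((f i).eval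
      (n : ℤ)).toNat))))).card : ℕ) : ℝ)| ≤ η * (((((Finset.Icc 1 x).filter (fun n : ℕ => ∀ i, 0 <
      (f i).eval (n : ℤ) ∧ ∀ p ∈ Finset.range ⌈(x : ℝ) ^ (((f i).natDegree : ℝ) / U)⌉₊, p.Prime → ¬
      ((p : ℤ) ∣ (f i).eval (n : ℤ)))).filter (fun n : ℕ => ∀ i : Fin k, ((i : ℕ) < (m : ℕ) →
      ArithmeticFunction.cardFactors (((f i).eval (n : ℤ)).toNat) = 1) ∧ ((m : ℕ) ≤ (i : ℕ) → Odd
      (ArithmeticFunction.cardFactors (((f i).eval (n : ℤ)).toNat))))).card : ℕ) : ℝ))) :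
    Summit.Parity.BatemanHorn.Theses.RoughParitySectors.OddSectorShareLinear :=
  OddSectorShareLinear_of_mixedShareSteps fun k f hf hdeg m =>
    mixedShareStep_of_mixedShareAnatomy k f m (hAnat k f hf hdeg m)

end Summit.Parity.BatemanHorn.Cruxes.OddSectorShareLinear.Birth

end
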